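import Summits.BirchSwinnertonDyer.BirchSwinnertonDyer.Theorems.EisensteinPrimesAcTwistDeformationCurveSurAtVbar
import Summits.BirchSwinnertonDyer.BirchSwinnertonDyer.Theorems.EisensteinPrimesAcTwistDeformationCurveSUROfTateTC
import Literature.NumberTheory.IwasawaTheory.Greenberg2006.CohomologyCofiniteGenerationLeTwoOfTateTC
import HarnessLib

/-!
# T28b re-typing (`OfTateTC`: Tate's formula by name AT TOTALLY COMPLEX FIELDS) of `EisensteinPrimesAcTwistDeformationCurveSurAtVbar.lean`

Route `EisensteinPrimes` (rung K5), crux 2 `GoodLatticeBDPValue` (stmt-BirchSwinnertonDyer-19032), line `halves`;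
cell `bsd-eis`, seat `bsd-line-x1-p1` LEAD g8, lane «T28 / TATE RE-PLUMB» (helper, `--supports`).

This file re-types, token for token, the theorems of `EisensteinPrimesAcTwistDeformationCurveSurAtVbar` that carry
Greenberg 2006 Prop. 3.2 BY NAME (`h32 : (∀ (L : Type) [Field L] [NumberField L] [IsTotallyComplex L], Literature.NumberTheory.GaloisCohomology.tateGlobalEulerPoincareCharacteristic L)`, cofinite generation of
`Hⁱ(K_Σ/K, 𝒟)` / `Hⁱ(K_v, 𝒟)` for EVERY `i`, every number field, every prime) with that hypothesis replaced by
Tate's global Euler–Poincaré characteristic BY NAME AT TOTALLY COMPLEX FIELDS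
(`h32 : ∀ L [IsTotallyComplex L], GaloisCohomology.tateGlobalEulerPoincareCharacteristic L`, Milne ADT I Thm. 5.1 — the shape the
tree's class-formation road to Tate's theorem delivers; where a theorem's field was not syntactically totally complex an
`[IsTotallyComplex K]` binder is added and supplied by its callers from `IsImaginaryQuadratic K` / `∀ w, w.IsComplex`): on this line
Prop. 3.2 is read in degrees `i ≤ 2` only (global clause; the local clause is the unconditional
`Greenberg2006.prop32_local_holds`), and in those degrees it follows from Tate's formula alone
(`Greenberg2006.prop32_global_le_two_of_tate_tc`, file `CohomologyCofiniteGenerationLeTwoOfTateTC`: `H⁰`/`H¹` of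
`G_{K,S}` with finite coefficients are finite unconditionally, `H²` by Tate, and Greenberg's dévissage for `Hⁿ`
involves `Hⁿ`, `Hⁿ⁻¹` only).  Statements are otherwise VERBATIM (same binder order, new names `<name>_ofTateTC`; supersedes this seat's `…OfTate` twin, which took Tate's formula at every number field);
proofs are the tree proofs with the two reading lemmas substituted and the re-typed callees called.
EFFECT for the crux: Harari Thm. 17.13 (a) (`poitouTate_restricted_three_le`) is no longer consumed through
Prop. 3.2 at every number field, only at totally complex fields (Greenberg 2006 Prop. 4.1 is typed totally
imaginary; `cd_p ≤ 2` and the `H²` bookkeeping at the imaginary quadratic `K`), which is what the tree's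
class-formation road (`RestrictedRamificationCdTwoOfH3Mu`, lane PT3-TC) proves.

Theorems only; no definition, no named fact, no `sorry`, no instance. HONEST FRAMING: conditional on the PUBLISHED
named facts carried as hypotheses; closes nothing by itself; no summit statement / BSD / the crux is proved here.

## References
* R. Greenberg, *On the structure of certain Galois cohomology groups*, Doc. Math. Extra Vol. Coates (2006), Prop. 3.2 (p. 358). [Greenberg2006]
* J. S. Milne, *Arithmetic Duality Theorems*, 2nd ed. (2006), I Thm. 5.1 (p. 67). [MilneADT2006]
* (the references of the re-typed file apply verbatim)
-/

set_option autoImplicit false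

noncomputable section

open scoped Classical
open NumberField IsDedekindDomain Field Multiplicative PowerSeries WeierstrassCurve
open Literature.NumberTheory.EllipticCurves Literature.NumberTheory.EllipticCurves.GreenbergSelmer
  Literature.NumberTheory.EllipticCurves.GreenbergVatsal2000 Literature.NumberTheory.GaloisRepresentations
  Literature.NumberTheory.EllipticCurves.KellerYin2024 Literature.NumberTheory.EllipticCurves.IwasawaDual
  Literature.NumberTheory.EllipticCurves.Castella2018.AcSelmer
  Literature.NumberTheory.IwasawaTheory Literature.NumberTheory.IwasawaTheory.Greenberg2016
  Literature.NumberTheory.IwasawaTheory.Greenberg2006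
  Summit.BirchSwinnertonDyer.BirchSwinnertonDyer.Theorems.GreenbergFullAtSelmer
  Summit.BirchSwinnertonDyer.BirchSwinnertonDyer.Theorems.AcTwistDeformationResidualPair

namespace Summit.BirchSwinnertonDyer.BirchSwinnertonDyer.Theorems.AcTwistDeformation

section CurveSurAtVbar

variable {K : Type} [Field K] [NumberField K] {p : ℕ} [Fact p.Prime]

/-- **[T28b `OfTateTC` re-typing: Greenberg 2006 Prop. 3.2 by name ↦ Milne ADT I Thm. 5.1 by name AT TOTALLY COMPLEX FIELDS (Prop. 3.2 is read in degrees ≤ 2 and at totally complex fields only, `prop32_global_le_two_of_tate_tc`).]** [cite: MilneADT2006, I Thm. 5.1 (p. 67)] **S2 = SUR_f AT `v̄` FROM THE FIVE GREENBERG FACTS + [PWL-θ]'s first clause, BY NAME.** See the module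
docstring: for `E = W/ℚ` base-changed to the imaginary quadratic `K` ((Heeg) for `N_E`), `2 < p = v v̄`, `κ`
anticyclotomic with topological generator `γ`, a residual pair of `E[p]` over `K`, `Sf` the places over `N_E`,
the `Sf`-imprimitive cotorsion hypotheses of the two characters, and Greenberg 2016 Prop. 2.6.3 / Greenberg
2006 Props. 4.1, 4.2, §5 A, 3.2 by name: there is `c : ℕ` with `κ(D_v̄) = p^c ℤ_p` exactly and, for every
`y : ℕ → H¹(ker κ ⊓ D_v̄, E_K[p^∞])`, some `u ∈ unramifiedOutside κ.kerSubgroup (E_K.geomPrimaryTorsion p) p ↑Sf`,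
locally trivial above every `w ∈ Sf`, `w ∤ p`, with `res_{ker κ ⊓ D_v̄}(conj_{γ^i} u) = y i` for all `i < p^c`.
[cite: Greenberg2016Selmer, Prop. 2.6.3 (c) (§2.6 p. 10), §4.3 pp. 20–21] [cite: Greenberg2006, Thm. 3 p. 342, Props. 3.2, 4.1, 4.2, §5 A]
[cite: PollackWeston2011, App. A Prop. A.2] [cite: KellerYin2024, Rem. 1.4.2 (arXiv:2402.12781v2 TeX L1130–1140)] -/
theorem curve_exists_forall_resOfLe_conjH1_pow_eq_at_vbar_ofTateTC (h263 : prop263_sur_of_crk)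
    (h41 : prop41_globalEulerPoincareCorank) (h42 : prop42_localEulerPoincareCorank)
    (h5A : sec5A_localH2_subsingleton_of_LOC1) (h32 : (∀ (L : Type) [Field L] [NumberField L] [IsTotallyComplex L], Literature.NumberTheory.GaloisCohomology.tateGlobalEulerPoincareCharacteristic L))
    (W : WeierstrassCurve ℚ) [W.IsElliptic] (hp : 2 < p) (hK : IsImaginaryQuadratic K)
    (hH : SatisfiesHeegnerHypothesis (W.conductorNorm ℤ) K)
    {ι : K →+* ℚ_[p]} {v vbar : HeightOneSpectrum (𝓞 K)}
    (hvι : ∀ x : 𝓞 K, x ∈ v.asIdeal ↔ ‖ι (x : K)‖ < 1)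
    (hvbar : ((p : ℕ) : 𝓞 K) ∈ vbar.asIdeal) (hne : vbar ≠ v)
    (κ : ZpExtension K p) (hκ : κ.IsAnticyclotomic) (γ : absoluteGaloisGroup K)
    [hγ : Fact (κ.IsTopGenerator γ)]
    {θsub θquot : FramedGaloisRep K (padicCoeffIntegers (∅ : Set (PadicAlgCl p))) 1}
    (hpair : IsResidualPairOver (W.baseChange K) p θsub θquot)
    (Sf : Finset (HeightOneSpectrum (𝓞 K)))
    (hSf : ∀ w : HeightOneSpectrum (𝓞 K), w ∈ Sf ↔ ((W.conductorNorm ℤ : ℤ) : 𝓞 K) ∈ w.asIdeal)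
    (hSsub : ∀ D : DatumDualData κ γ (charModule (∅ : Set (PadicAlgCl p)) θsub)
      (bdpData (charModule (∅ : Set (PadicAlgCl p)) θsub) p vbar) (↑Sf : Set (HeightOneSpectrum (𝓞 K))),
      Module.Finite (IwasawaAlgebra p) D.X ∧ Module.IsTorsion (IwasawaAlgebra p) D.X ∧
        muInvariant p D.X = 0)
    (hSquot : ∀ D : DatumDualData κ γ (charModule (∅ : Set (PadicAlgCl p)) θquot)
      (bdpData (charModule (∅ : Set (PadicAlgCl p)) θquot) p vbar) (↑Sf : Set (HeightOneSpectrum (𝓞 K))),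
      Module.Finite (IwasawaAlgebra p) D.X ∧ Module.IsTorsion (IwasawaAlgebra p) D.X ∧
        muInvariant p D.X = 0) :
    ∃ c : ℕ, (∃ δ ∈ decomp (K := K) vbar, (κ δ).toAdd = (p : ℤ_[p]) ^ c) ∧
      (∀ δ ∈ decomp (K := K) vbar, (p : ℤ_[p]) ^ c ∣ (κ δ).toAdd) ∧
      ∀ y : ℕ → subgroupH1 (κ.kerSubgroup ⊓ decomp (K := K) vbar) ((W.baseChange K).geomPrimaryTorsion p),
        ∃ u ∈ unramifiedOutside κ.kerSubgroup ((W.baseChange K).geomPrimaryTorsion p) p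
            (↑Sf : Set (HeightOneSpectrum (𝓞 K))),
          (∀ w ∈ Sf, ((p : ℕ) : 𝓞 K) ∉ w.asIdeal → ∀ σ : absoluteGaloisGroup K,
            conjH1 κ.kerSubgroup ((W.baseChange K).geomPrimaryTorsion p) σ u ∈
              awayKer κ.kerSubgroup ((W.baseChange K).geomPrimaryTorsion p) w) ∧
          ∀ i : ℕ, i < p ^ c →
            resOfLe ((W.baseChange K).geomPrimaryTorsion p)
              (inf_le_left : κ.kerSubgroup ⊓ decomp (K := K) vbar ≤ κ.kerSubgroup)
              (conjH1 κ.kerSubgroup ((W.baseChange K).geomPrimaryTorsion p) (γ ^ i) u) = y i := by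
  haveI hEK : (W.baseChange K).IsElliptic := inferInstanceAs (W.map (algebraMap ℚ K)).IsElliptic
  have hv : ((p : ℕ) : 𝓞 K) ∈ v.asIdeal := IwasawaTwoVariable.natCast_mem_asIdeal_of_norm_iff hvι
  -- `v̄` is finitely decomposed in `K_∞`: `κ(D_v̄) = p^c ℤ_p` exactly
  have hdec : ¬ decomp (K := K) vbar ≤ κ.kerSubgroup := fun hle ↦ by
    obtain ⟨σ, hσ⟩ := exists_local_apply_ne_one_of_natCast_mem hK κ hvbar
    exact hσ (ZpExtension.mem_kerSubgroup.mp (hle ((mem_decomp_iff vbar _).mpr ⟨σ, rfl⟩)))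
  obtain ⟨c, ⟨d₀, hd₀⟩, -, hdvd⟩ :=
    UniversalToricDescentSigmaLocalStabilizer.exists_pow_and_forall_dvd_of_not_le κ vbar hdec
  have hd₀' : ∃ δ ∈ decomp (K := K) vbar, (κ δ).toAdd = (p : ℤ_[p]) ^ c := ⟨d₀, d₀.2, hd₀⟩
  have hdiv' : ∀ δ ∈ decomp (K := K) vbar, (p : ℤ_[p]) ^ c ∣ (κ δ).toAdd := fun δ hδ ↦ hdvd ⟨δ, hδ⟩
  refine ⟨c, hd₀', hdiv', fun y ↦ ?_⟩
  -- `S = {v, v̄} ∪ Sf` contains the places above `p` and the bad places of `E_K`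
  set S : Set (HeightOneSpectrum (𝓞 K)) := (↑(insert v (insert vbar Sf)) : Set (HeightOneSpectrum (𝓞 K)))
    with hSdef
  have hS : ∀ w : HeightOneSpectrum (𝓞 K), ((p : ℕ) : 𝓞 K) ∈ w.asIdeal → w ∈ S :=
    mem_insert_insert_of_natCast_mem hK hv hvbar hne Sf
  have hSfS : ∀ w ∈ Sf, w ∈ S := fun w hw ↦ by
    rw [hSdef, Finset.coe_insert, Finset.coe_insert]
    exact Or.inr (Or.inr (Finset.mem_coe.mpr hw))
  have hgoodN : ∀ w : HeightOneSpectrum (𝓞 K), w ∉ Sf → (W.baseChange K).HasGoodReductionAt w := fun w hw ↦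
    EisensteinPrimesMuLambda.hasGoodReductionAt_baseChange_of_conductorNorm_notMem W w fun h ↦ hw ((hSf w).mpr h)
  have hSbad : ∀ w : HeightOneSpectrum (𝓞 K), ¬ (W.baseChange K).HasGoodReductionAt w → w ∈ S :=
    fun w hw ↦ hSfS w (by_contra fun hw' ↦ hw (hgoodN w hw'))
  have hgood : ∀ w : HeightOneSpectrum (𝓞 K), w ∉ S → ((p : ℕ) : 𝓞 K) ∉ w.asIdeal →
      (W.baseChange K).HasGoodReductionAt w := fun w hw _ ↦ hgoodN w fun h ↦ hw (hSfS w h)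
  -- the model `ρ₀` of `E_K[p^∞]` over `G_{K,S}` (Néron–Ogg–Shafarevich)
  have hNS : ∀ n ∈ ramificationSubgroup K S, ∀ P : PrimaryTorsion (W.baseChange K).geomPoints p, n • P = P :=
    fun n hn P ↦ SignedBaseChangeAcDivCurveModel.smul_primaryTorsion_eq_of_mem_ramificationSubgroup
      (W.baseChange K) p S hSbad hS hn P
  obtain ⟨ρ₀, hρ₀⟩ := SignedBaseChangeAcDivCurveModel.exists_continuousRep_primaryTorsion (W.baseChange K) p S hNS
  -- the canonical (discrete) topological instances of the arena
  letI tΛ : TopologicalSpace (PowerSeries ℤ_[p]) := ⊥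
  haveI : DiscreteTopology (PowerSeries ℤ_[p]) := ⟨rfl⟩
  haveI : IsTopologicalRing (PowerSeries ℤ_[p]) := inferInstance
  haveI : IsTopologicalAddGroup (BigRepModule ℤ_[p] p (PrimaryTorsion (W.baseChange K).geomPoints p)) :=
    inferInstance
  haveI : ContinuousSMul (PowerSeries ℤ_[p]) (BigRepModule ℤ_[p] p (PrimaryTorsion (W.baseChange K).geomPoints p)) :=
    inferInstance
  -- `K` imaginary quadratic
  haveI := hK.2
  have hKc : ∀ w : InfinitePlace K, w.IsComplex := IsTotallyComplex.isComplex
  -- `corank_Λ S_{𝓛_v}(K, 𝐃_E) = 0` from the cotorsion of `X_ac` (p635638)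
  obtain ⟨-, hXfin, hXtor, -⟩ :=
    Thm141TorsionClauses.moduleFinite_isTorsion_muInvariant_eq_zero_of_forall_dualData W hp K hK vbar hvbar κ
      hκ γ hpair Sf hSf hSsub hSquot
  obtain ⟨hSel, -⟩ := hasCorank_fullAtSelmer_zero_of_xAc S (W.baseChange K) hS κ ρ₀ hρ₀ hKc hv hvbar hne
    hgood hXfin hXtor
  -- SUR(`𝐃_E`, `𝓛_v`)
  have hSUR := primaryTorsion_fullAt_SUR_ofTateTC (W.baseChange K) hS κ ρ₀ h263 h41 h42 h5A h32 (Finset.finite_toSet _)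
    hK (exists_local_apply_ne_one_of_mem_insert_insert hK hp hH κ hκ hv hvbar Sf hSf) hne hv hvbar hSel
  -- the Shapiro descent with `ψ = id`
  let ψ : PrimaryTorsion (W.baseChange K).geomPoints p ≃+ (W.baseChange K).geomPrimaryTorsion p :=
    AddEquiv.refl _
  have hψ : ∀ (σ : absoluteGaloisGroup K) (a : PrimaryTorsion (W.baseChange K).geomPoints p),
      ψ (ρ₀ (toUnramifiedQuot K S σ) a) = σ • ψ a := fun σ a ↦ by rw [hρ₀]; rfl
  have hA : ∀ a : PrimaryTorsion (W.baseChange K).geomPoints p, ∃ k : ℕ, p ^ k • a = 0 := fun a ↦ by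
    obtain ⟨k, hk⟩ := a.exists_pow_smul_eq_zero
    exact ⟨k, PrimaryTorsion.ext (by rw [PrimaryTorsion.val_nsmul]; exact hk)⟩
  obtain ⟨F, hF⟩ := exists_shapiroDescent S hS κ ρ₀ ψ hψ
  -- the target family, supported at `v̄`; representatives `γ^i`
  let y' : ∀ w : HeightOneSpectrum (𝓞 K), ℕ →
      subgroupH1 (κ.kerSubgroup ⊓ decomp (K := K) w) ((W.baseChange K).geomPrimaryTorsion p) :=
    fun w i ↦ if hw : w = vbar then hw ▸ y i else 0
  have hy' : ∀ i : ℕ, y' vbar i = y i := fun i ↦ by simp [y']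
  have hσrep : ∀ w ∈ ({vbar} : Finset (HeightOneSpectrum (𝓞 K))), ∀ i : ℕ, i < p ^ (fun _ ↦ c) w →
      (κ ((fun (_ : HeightOneSpectrum (𝓞 K)) (i : ℕ) ↦ γ ^ i) w i)).toAdd = (i : ℤ_[p]) := fun w _ i _ ↦ by
    change (κ (γ ^ i)).toAdd = (i : ℤ_[p])
    rw [map_pow, show κ γ = Multiplicative.ofAdd 1 from hγ.out, ← ofAdd_nsmul, toAdd_ofAdd, nsmul_one]
  have hvbarS : ∀ w ∈ ({vbar} : Finset (HeightOneSpectrum (𝓞 K))), w ∈ S := fun w hw ↦ by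
    rw [Finset.mem_singleton] at hw
    subst hw
    exact hS w hvbar
  have hvbarv : ∀ w ∈ ({vbar} : Finset (HeightOneSpectrum (𝓞 K))), w ≠ v := fun w hw ↦ by
    rw [Finset.mem_singleton] at hw
    subst hw
    exact hne
  obtain ⟨u, hunr, haway, hev⟩ := exists_mem_unramifiedOutside_forall_resOfLe_conjH1_eq_of_SUR S hS κ ρ₀ ψ hψ
    hv hSUR hA hF {vbar} hvbarS hvbarv (fun _ ↦ c)
    (fun w hw ↦ by rw [Finset.mem_singleton] at hw; subst hw; exact hdiv')
    (fun w hw ↦ by rw [Finset.mem_singleton] at hw; subst hw; exact hd₀') (fun _ i ↦ γ ^ i) hσrep y'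
  refine ⟨u, ?_, fun w hw hpw σ ↦ ?_, fun i hi ↦ (hev vbar (Finset.mem_singleton_self vbar) i hi).trans (hy' i)⟩
  · -- unramified outside `{v̄} ∪ {w ∣ p}` ⇒ unramified outside `Sf ∪ {w ∣ p}`
    rw [mem_unramifiedOutside_iff] at hunr ⊢
    intro w _ hpw σ
    exact hunr w (fun hw ↦ hpw (by
      rw [Finset.coe_singleton, Set.mem_singleton_iff] at hw
      exact hw ▸ hvbar)) hpw σ
  · -- locally trivial above `w ∈ Sf`, `w ∤ p`
    refine haway w (hSfS w hw) (fun h' ↦ hpw (h' ▸ hv)) (fun hw' ↦ ?_) σ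
    rw [Finset.mem_singleton] at hw'
    exact hpw (hw' ▸ hvbar)

end CurveSurAtVbar

end Summit.BirchSwinnertonDyer.BirchSwinnertonDyer.Theorems.AcTwistDeformation

end
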